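import Summits.Schanuel.Schanuel.Theorems.ZilberEacResonantTranscendence
import Mathlib.RingTheory.Polynomial.Tower
import HarnessLib

/-!
# The equimodular class, XII: `exp(p(z) - P̃(z - L(z)))` is transcendental over `ℂ(z)` for a
# primitive `L` of the logarithmic derivative of a non-constant rational function (`deg P̃ ≥ 2`)

HONEST FRAMING.  Cell `pub-schanuel` (Zilber's Exponential-Algebraic Closedness, case ladder;
host summit Schanuel), seat 2, gen 23.  The algebraic heart of the transcendence mechanism over
polynomial graph bases `x₁ = p(x₀)` of ARBITRARY degree (gen 22, file III, is the case
`P̃ = c(X - τ)² + κ'`, where the logarithmic derivative is affine in `L`):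
**`not_algebraic_graphExp`** — with `A, B, a, L, z₀` as in file II (`L' = (AB' - A'B)/(AB)` near
`z₀`, `(AB)(z₀) ≠ 0`, `(AB' - A'B)(z₀) ≠ (AB)(z₀)`, a root of exactly one of `A, B`), for ALL
`p, P̃ ∈ ℂ[X]` with `deg P̃ ≥ 2` the function `w(z) = exp(p(z) - P̃(z - L(z)))` satisfies NO nonzero
relation `H(z, w(z)) = 0` near `z₀`.  Proof in the germ domain `AGerm z₀` (file I): a relation of
minimal `t`-degree, differentiated (`w'/w = p'(z) - P̃'(z - L)(1 - g)`, `g = L' ∈ ℂ(z)`), gives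
`(1 - g)·D·P̃'(z - L) = p'·D + E` with `D ≠ 0`, so `P̃'(z - L)` is algebraic over `ℂ[z]`; as
`deg P̃' ≥ 1`, `z - L` and hence `L` are algebraic over `ℂ[z]` (`IsAlgebraic.of_aeval`) —
contradicting file II.  [folklore differential algebra, made concrete]; nothing here is specific to
Schanuel's conjecture (neither used nor implied); Mantova–Masser's question and EC(3,2) stay OPEN.
-/

noncomputable section

open Filter Topology Polynomial

set_option linter.dupNamespace false

namespace Summit.Schanuel.Schanuel.Theorems

/-! ## Part A. `aeval` at a germ is the germ of the composed function -/

/-- A polynomial of an analytic function is analytic. [folklore] -/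
theorem analyticAt_polynomial_eval_comp {z₀ : ℂ} {f : ℂ → ℂ} (hf : AnalyticAt ℂ f z₀) (Q : ℂ[X]) :
    AnalyticAt ℂ (fun z => Q.eval (f z)) z₀ := by
  induction Q using Polynomial.induction_on' with
  | add p q hp hq =>
    simp only [Polynomial.eval_add]
    exact hp.add hq
  | monomial n a =>
    simp only [Polynomial.eval_monomial]
    exact analyticAt_const.mul (hf.pow n)

/-- **`aeval` at the germ of `f` is the germ of `z ↦ Q(f z)`.** [folklore] -/
theorem aeval_mk {z₀ : ℂ} {f : ℂ → ℂ} (hf : AnalyticAt ℂ f z₀) (Q : ℂ[X])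
    (hQf : AnalyticAt ℂ (fun z => Q.eval (f z)) z₀) :
    Polynomial.aeval (AGerm.mk z₀ hf) Q = AGerm.mk z₀ hQf := by
  induction Q using Polynomial.induction_on' with
  | add p q hp hq =>
    rw [map_add, hp (analyticAt_polynomial_eval_comp hf p), hq (analyticAt_polynomial_eval_comp hf q),
      ← AGerm.mk_add]
    exact AGerm.mk_congr _ _ fun z => by simp
  | monomial n a =>
    rw [Polynomial.aeval_monomial, ← AGerm.mk_const, ← AGerm.mk_pow, ← AGerm.mk_mul]
    exact AGerm.mk_congr _ _ fun z => by simp [Polynomial.eval_monomial]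

/-! ## Part B. The transcendence theorem -/

/-- **`w = exp(p(z) - P̃(z - L z))` is transcendental over `ℂ(z)` when `deg P̃ ≥ 2`.**  `A, B ∈ ℂ[z]`
nonzero with a point that is a root of exactly one of them; `L` analytic at `z₀` with
`L' = (A B' - A' B)/(A B)` near `z₀`; `(A B)(z₀) ≠ 0` and `(A B' - A' B)(z₀) ≠ (A B)(z₀)`.  Then no
nonzero `H ∈ ℂ[s][t]` has `H(z, w(z)) = 0` near `z₀`. [folklore differential algebra] (new in this
form) -/
theorem not_algebraic_graphExp {z₀ : ℂ} {A B : ℂ[X]} (hA : A ≠ 0) (hB : B ≠ 0)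
    {a : ℂ} (ha : (A.IsRoot a ∧ ¬ B.IsRoot a) ∨ (B.IsRoot a ∧ ¬ A.IsRoot a))
    {L : ℂ → ℂ} (hLan : AnalyticAt ℂ L z₀)
    (hL : ∀ᶠ z in 𝓝 z₀,
      HasDerivAt L ((A * derivative B - derivative A * B).eval z / (A * B).eval z) z)
    (h0 : (A * B).eval z₀ ≠ 0)
    (h1 : (A * derivative B - derivative A * B).eval z₀ ≠ (A * B).eval z₀)
    (p Pt : ℂ[X]) (hPt : 2 ≤ Pt.natDegree) {H : ℂ[X][X]} (hH0 : H ≠ 0)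
    (hH : ∀ᶠ z in 𝓝 z₀, (H.map (Polynomial.evalRingHom z)).eval
      (Complex.exp (p.eval z - Pt.eval (z - L z))) = 0) : False := by
  set R₀ : ℂ[X] := A * B with hR₀
  set R₁ : ℂ[X] := A * derivative B - derivative A * B with hR₁
  -- the functions and their germs
  set g : ℂ → ℂ := fun z => R₁.eval z / R₀.eval z with hg
  have hgan : AnalyticAt ℂ g z₀ :=
    (analyticAt_polynomial_eval R₁ z₀).div (analyticAt_polynomial_eval R₀ z₀) h0
  have hsub : AnalyticAt ℂ (fun z => z - L z) z₀ := analyticAt_id.sub hLan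
  have hPtan : AnalyticAt ℂ (fun z => Pt.eval (z - L z)) z₀ := analyticAt_polynomial_eval_comp hsub Pt
  have hPt'an : AnalyticAt ℂ (fun z => (derivative Pt).eval (z - L z)) z₀ :=
    analyticAt_polynomial_eval_comp hsub (derivative Pt)
  set q : ℂ → ℂ := fun z => p.eval z - Pt.eval (z - L z) with hq
  have hqan : AnalyticAt ℂ q z₀ := (analyticAt_polynomial_eval p z₀).sub hPtan
  set w : ℂ → ℂ := fun z => Complex.exp (q z) with hw
  have hwan : AnalyticAt ℂ w z₀ := hqan.cexp
  set q' : ℂ → ℂ := fun z => (derivative p).eval z - (derivative Pt).eval (z - L z) * (1 - g z)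
    with hq'
  have hq'an : AnalyticAt ℂ q' z₀ :=
    (analyticAt_polynomial_eval _ z₀).sub (hPt'an.mul (analyticAt_const.sub hgan))
  set wO := AGerm.mk z₀ hwan with hwO
  set LO := AGerm.mk z₀ hLan with hLO
  set gO := AGerm.mk z₀ hgan with hgO
  have hwO0 : wO ≠ 0 := AGerm.mk_ne_zero_of_forall_ne_zero hwan fun z => Complex.exp_ne_zero _
  -- a relation of minimal degree
  have hHO : germEval₂ z₀ wO H = 0 := (germEval₂_mk_eq_zero_iff hwan H).2 hH
  clear hH
  obtain ⟨H, hH0, hHO, hmin⟩ := exists_minDegree_of_exists (germEval₂ z₀ wO) ⟨H, hH0, hHO⟩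
  set M := H.natDegree with hM
  -- the differentiated function identity
  have hF : (fun z => (H.map (Polynomial.evalRingHom z)).eval (w z)) =ᶠ[𝓝 z₀] 0 :=
    (germEval₂_mk_eq_zero_iff hwan H).1 hHO
  have hR₀ev : ∀ᶠ z in 𝓝 z₀, R₀.eval z ≠ 0 :=
    (Polynomial.differentiable R₀).continuous.continuousAt.eventually_ne h0
  have hFF : ∀ᶠ z in 𝓝 z₀, (fun y => (H.map (Polynomial.evalRingHom y)).eval (w y)) =ᶠ[𝓝 z] 0 :=
    eventually_eventually_nhds.2 hF
  have hE : ∀ᶠ z in 𝓝 z₀, ((coeffDeriv H).map (Polynomial.evalRingHom z)).eval (w z) +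
      q' z * ((weightDeg H).map (Polynomial.evalRingHom z)).eval (w z) = 0 := by
    filter_upwards [hL, hR₀ev, hFF] with z hLz hR₀z hFz
    -- `q` and `w` are differentiable at `z` with `w' = w q'`
    have hqd : HasDerivAt q (q' z) z := by
      have h1 : HasDerivAt (fun y : ℂ => y - L y) (1 - g z) z := (hasDerivAt_id z).sub hLz
      have h2 : HasDerivAt (fun y => Pt.eval (y - L y))
          ((derivative Pt).eval (z - L z) * (1 - g z)) z :=
        HasDerivAt.comp z (h₂ := fun y => Pt.eval y) (Polynomial.hasDerivAt Pt (z - L z)) h1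
      exact (Polynomial.hasDerivAt p z).sub h2
    have hwd : HasDerivAt w (w z * q' z) z := hqd.cexp
    -- derivative of `F`
    have e : (fun y => (H.map (Polynomial.evalRingHom y)).eval (w y)) =
        fun y => ∑ j ∈ Finset.range (M + 1), (H.coeff j).eval y * w y ^ j :=
      funext fun y => evalPP_eq_sum H y (w y) (Nat.lt_succ_self _)
    have hderF : HasDerivAt (fun y => (H.map (Polynomial.evalRingHom y)).eval (w y))
        (∑ j ∈ Finset.range (M + 1), ((derivative (H.coeff j)).eval z * w z ^ j +
          (H.coeff j).eval z * ((j : ℂ) * w z ^ (j - 1) * (w z * q' z)))) z := by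
      rw [e]
      exact HasDerivAt.fun_sum fun j _ => (Polynomial.hasDerivAt (H.coeff j) z).fun_mul (hwd.fun_pow j)
    have hzero := hderF.unique ((hasDerivAt_const z (0 : ℂ)).congr_of_eventuallyEq hFz)
    rw [eval_coeffDeriv, eval_weightDeg, Finset.mul_sum, ← Finset.sum_add_distrib, ← hzero]
    refine Finset.sum_congr rfl fun j _ => ?_
    rcases Nat.eq_zero_or_pos j with hj | hj
    · subst hj; simp
    · obtain ⟨k, rfl⟩ : ∃ k, j = k + 1 := ⟨j - 1, (Nat.sub_add_cancel hj).symm⟩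
      simp only [Nat.add_sub_cancel, pow_succ]
      ring
  -- the identity in the germ domain
  have hq'O : AGerm.mk z₀ hq'an =
      Polynomial.aeval (zGerm z₀) (derivative p) -
        Polynomial.aeval (zGerm z₀ - LO) (derivative Pt) * (1 - gO) := by
    have hzL : zGerm z₀ - LO = AGerm.mk z₀ hsub := rfl
    rw [hzL, aeval_zGerm, aeval_mk hsub (derivative Pt) hPt'an]
    rfl
  have hEO : germEval₂ z₀ wO (coeffDeriv H) + AGerm.mk z₀ hq'an * germEval₂ z₀ wO (weightDeg H) = 0 := by
    have hEan : AnalyticAt ℂ (fun z => ((coeffDeriv H).map (Polynomial.evalRingHom z)).eval (w z) +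
        q' z * ((weightDeg H).map (Polynomial.evalRingHom z)).eval (w z)) z₀ :=
      (analyticAt_evalPP hwan _).add (hq'an.mul (analyticAt_evalPP hwan _))
    have h := (AGerm.mk_eq_zero_iff hEan).2 hE
    rw [germEval₂_mk, germEval₂_mk]
    exact h
  rw [hq'O] at hEO
  -- `D ≠ 0`, `1 - g ≠ 0`
  have hD : germEval₂ z₀ wO (weightDeg H) ≠ 0 := germEval₂_weightDeg_ne_zero hwO0 hH0 hHO hmin
  have h1g : (1 : AGerm z₀) - gO ≠ 0 := by
    have h1gan : AnalyticAt ℂ (fun z => 1 - g z) z₀ := analyticAt_const.sub hgan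
    have : (1 : AGerm z₀) - gO = AGerm.mk z₀ h1gan := rfl
    rw [this]
    refine AGerm.mk_ne_zero_of_apply_ne_zero h1gan ?_
    rw [hg]
    intro h
    apply h1
    field_simp at h
    linear_combination -h
  -- `δ β = ν` with `β = P̃'(z - L)`
  set β : AGerm z₀ := Polynomial.aeval (zGerm z₀ - LO) (derivative Pt) with hβ
  set δ : AGerm z₀ := (1 - gO) * germEval₂ z₀ wO (weightDeg H) with hδ
  set ν : AGerm z₀ := Polynomial.aeval (zGerm z₀) (derivative p) * germEval₂ z₀ wO (weightDeg H) +
    germEval₂ z₀ wO (coeffDeriv H) with hν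
  have hδ0 : δ ≠ 0 := mul_ne_zero h1g hD
  have hβδ : δ * β = ν := by
    rw [hδ, hν]
    linear_combination -hEO
  -- algebraicity over `ℂ[zGerm]`
  set Bz := Algebra.adjoin ℂ ({zGerm z₀} : Set (AGerm z₀)) with hBz
  have hwalg : IsAlgebraic Bz wO := isAlgebraic_of_germEval₂_eq_zero wO hH0 hHO
  have hgalg : IsAlgebraic Bz gO := by
    have hR₀O0 : Polynomial.aeval (zGerm z₀) R₀ ≠ 0 := aeval_zGerm_ne_zero z₀ (mul_ne_zero hA hB)
    refine IsAlgebraic.of_mul (mem_nonZeroDivisors_of_ne_zero hR₀O0) (isAlgebraic_aeval_zGerm z₀ R₀) ?_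
    have hmul : Polynomial.aeval (zGerm z₀) R₀ * gO = Polynomial.aeval (zGerm z₀) R₁ := by
      rw [aeval_zGerm, aeval_zGerm, hgO, ← AGerm.mk_mul]
      refine (AGerm.mk_eq_mk_iff _ _).2 ?_
      filter_upwards [hR₀ev] with z hz
      simp only [Pi.mul_apply, hg]
      field_simp
    rw [hmul]
    exact isAlgebraic_aeval_zGerm z₀ R₁
  have hzalg : IsAlgebraic Bz (zGerm z₀) := isAlgebraic_aeval_zGerm z₀ Polynomial.X |> fun h => by
    rwa [Polynomial.aeval_X] at h
  have hδalg : IsAlgebraic Bz δ := (isAlgebraic_one.sub hgalg).mul (isAlgebraic_germEval₂ hwalg _)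
  have hνalg : IsAlgebraic Bz ν :=
    ((isAlgebraic_aeval_zGerm z₀ _).mul (isAlgebraic_germEval₂ hwalg _)).add
      (isAlgebraic_germEval₂ hwalg _)
  have hβalg : IsAlgebraic Bz β :=
    IsAlgebraic.of_mul (mem_nonZeroDivisors_of_ne_zero hδ0) hδalg (by rw [hβδ]; exact hνalg)
  -- `z - L` is algebraic: `P̃'` has degree `≥ 1`
  have hγalg : IsAlgebraic Bz (zGerm z₀ - LO) := by
    have hinj : Function.Injective (algebraMap ℂ Bz) := (algebraMap ℂ Bz).injective
    set Q : Polynomial Bz := (derivative Pt).map (algebraMap ℂ Bz) with hQ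
    have hQβ : Polynomial.aeval (zGerm z₀ - LO) Q = β := by
      rw [hQ, Polynomial.aeval_map_algebraMap]
    have hdeg' : (derivative Pt).natDegree = Pt.natDegree - 1 := Polynomial.natDegree_derivative Pt
    have hQdeg : Q.natDegree ≠ 0 := by
      rw [hQ, Polynomial.natDegree_map_eq_of_injective hinj, hdeg']
      omega
    have hPt'0 : derivative Pt ≠ 0 := by
      intro h
      rw [h, Polynomial.natDegree_zero] at hdeg'
      omega
    have hQlc : Q.leadingCoeff ∈ nonZeroDivisors Bz := by
      refine mem_nonZeroDivisors_of_ne_zero ?_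
      rw [hQ, Polynomial.leadingCoeff_map_of_injective hinj, Ne, map_eq_zero_iff _ hinj]
      exact Polynomial.leadingCoeff_ne_zero.2 hPt'0
    exact IsAlgebraic.of_aeval Q hQdeg hQlc (by rw [hQβ]; exact hβalg)
  have hLalg : IsAlgebraic Bz LO := by
    have h := hzalg.sub hγalg
    rwa [sub_sub_cancel] at h
  -- a relation for `L`: contradiction with file II
  obtain ⟨P, hP0, hPev⟩ := exists_polyPoly_relation hLalg
  exact not_algebraic_of_hasDerivAt_logDeriv hA hB ha hLan hL h0 hP0 hPev

end Summit.Schanuel.Schanuel.Theorems
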